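import Summits.NavierStokesRegularity.NavierStokesRegularity.Theses.AxisymmetricExtremality
import Summits.NavierStokesRegularity.NavierStokesRegularity.Theorems.AxisymmetricExtremalityPFoldToAxisymmetric
import Summits.NavierStokesRegularity.NavierStokesRegularity.Theorems.AxisymmetricExtremalityMinimalDatumPFoldShiftRigidity
import Literature.Analysis.FluidPDE.HomSobolevRepresentedL3

/-!
# Disproof of `MinimalDatumPFold` — findings (cdisprove, cycle 1, 2026-08-17)

Crux item `stmt-NavierStokesRegularity-15452`, decl
`Summit.NavierStokesRegularity.NavierStokesRegularity.Theses.AxisymmetricExtremality.MinimalDatumPFold`,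
route `AxisymmetricExtremality`; live line `symmetric-gap` (lead c1), whose one open stub is
`stub_symmGapClosing` (ρ_p = ρ_max in infimum form).

VERDICT OF THIS CYCLE: **no kill is possible in ZFC-without-settling-Clay, and this is a theorem**
(§1): the crux's antecedent is verbatim the failure of Clay (A) at `ν`, so
`MinimalDatumPFold ∨ ¬ NavierStokesRegularity` (`minimalDatumPFold_or_not_navierStokesRegularity`), i.e.
`¬ MinimalDatumPFold → ¬ NavierStokesRegularity`; the same holds for the open stub of the live line
(`symmGapClosingSig_or_not_navierStokesRegularity`). Every refutation of the crux, of the stub, or of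
ANY statement keeping that antecedent is a proof of finite-time blow-up for a Schwartz-class datum.

INDEX
* §0  vocabulary (`ClayFails`, `rot`, `IsPFold`, `PFoldConclusion`) and `minimalDatumPFold_iff`
      (`Iff.rfl` read-back of the decl).
* §1  RESISTANCE CERTIFICATES (sorry-free): summit ⇒ crux; ¬crux ⇒ ¬summit; the exact residual
      `¬ MinimalDatumPFold ↔ ∃ ν > 0, ClayFails ν ∧ ¬ PFoldConclusion ν`; and, using the PROVED
      sibling crux `PFoldToAxisymmetric`, the normal form
      `MinimalDatumPFold ↔ (∀ ν > 0, ClayFails ν → ∃ axisymmetric minimal blow-up datum)`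
      (`minimalDatumPFold_iff_axisymmetricForm`): refuting the crux = exhibiting a viscosity with
      blow-up but NO axisymmetric Rusin–Šverák minimiser.
* §2  LOAD-BEARING HYPOTHESES. (H1) the Clay-failure antecedent: dropping it
      (`MinimalDatumPFoldWithoutClayFailure`) turns the crux into an unconditional assertion of
      minimal blow-up data at every `ν > 0` (`withoutClayFailure_forces_minimalBlowup`,
      `…_forces_thresholdFinite`), false as soon as one viscosity is Kato-regular
      (`minimalDatumPFold_false_without_clayFailure_of_katoRegular`) — "any proof must use the
      antecedent", to the extent regularity is true; unconditionally irrefutable for the dual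
      reason (it asserts blow-up). (H2) `0 < ν`: inseparable parameter, not analysed. (H3) `2 ≤ p`
      / `N ≤ p`: `2 ≤ p` only excludes `R = id`; with `N ≤ p` dropped the statement is still
      irrefutable (same antecedent). (H4) pointwise `∀ x` equivariance: harmless (landed
      `stub_liftAeToExact`, p149205, upgrades a.e. to everywhere inside `M`).
* §3  THE NATURAL STRENGTHENING IS FALSE (sorry-free toy): the ABSTRACT extremality principle
      behind line `birth` ("a closed rotation-invariant bad set with a non-empty compact set of
      norm-minimisers and symmetric bad elements for every `p` has a `p`-fold symmetric minimiser
      for unboundedly many `p`") fails already in `ℝ³` with the route's own rotation `R_{2π/p}`: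
      `not_abstractExtremality`. The minimiser set of the witness is a free `SO(2)`-orbit (a
      horizontal circle, χ = 0): exactly the scenario "M̂ a union of free-ish orbits" of the route's
      why-might-fail. CONSEQUENCE FOR PROVERS: non-emptiness + compactness of `M` (Rusin–Šverák,
      proved) + rotation invariance + `ρ_p < ∞` do NOT imply the crux; the missing input is either
      topological (`F_p`-acyclicity of `M̂`, no source) or analytic (gap closing `ρ_p = ρ_max`).
* §3b the DIHEDRAL/PRISMATIC reshape (2-groups `⟨R_{2π/2^k}, σ⟩` of the three planner cards) meets the
      same witness: `not_abstractExtremality_dihedral` — `F_2`-acyclicity is equally load-bearing there.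
* §4  LINE `symmetric-gap`: joint sufficiency is LANDED (p152445), nothing to attack; clause
      mutation of the open stub's conclusion: without the blow-up clause it is witnessed by the
      zero datum (`symmGap_conclusion_trivial_without_blowup`), without the equivariance clause it
      is the definition of the threshold (`exists_blowupDatum_norm_lt_of_thresholdFinite`); the
      open content is precisely the COUPLING near-minimal ∧ equivariant.
* §5  Targets: none served (payload `targets`/`stuck_stubs` empty). Line `Sketch` (lead c2): see the
      LINE `Sketch` paragraph below (tightness of `stub_axisymConcentrationBranch`, p159492).
* §6  NEAR-MISSES / dead refutation strategies (docstrings): necklaces (`ρ_p < ∞`) need robustness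
      of blow-up under far-field superposition (GKP weak-usc of `T*`, not in tree); "ρ_p = ∞"
      strategies are therefore dead too; junk regimes (`ν ≤ 0`, `p ∈ {0,1}`) are excluded by the
      binders; no finite/decidable instance exists (nothing to `decide`).

LINE `Sketch` (lead c2, picked 2026-08-17T11:01Z; skeleton `Lines/Sketch.lean`): stubs 1–3 LANDED
(p157006, p157748, p158054); open residual `stub_axisymConcentrationBranch` (Clay failure ⇒ exactly
axisymmetric SUB-threshold data whose mild solutions on [0,1) concentrate at (1, x k)); `stub_branchOfAxisymMinimalDatum`
is the unused dominance converse. JOINT SUFFICIENCY checked: `MinimalDatumPFold_of` composes stub 4 with the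
landed stubs and lifts only — honest, no circularity. REFUTABILITY: none (antecedent = Clay failure; over the
tree the residual ⟺ crux). TIGHTNESS (kernel-checked, `Negative/ConcentrationCostsThreshold.lean`, p159492):
`threshold_le_of_concentration` (concentration at (1, x k) with ‖G k‖ ≤ R forces ρ_max^pure ≤ R — from the
lead's landed stubs 1–2 + weak compactness / lsc), `no_concentration_uniformly_below_threshold` (the stub is
FALSE with a UNIFORM sub-threshold bound ‖G k‖ₑ ≤ ρ' < ρ_max; no symmetry used),
`frequently_threshold_approached_of_concentration` (every witness saturates the threshold:
limsup ‖G k‖ₑ = ρ_max). So the only possible witnesses are threshold-saturating families (`c_k • φ`, `c_k ↑ 1`,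
`φ` an axisymmetric threshold object) — the line's Stub 5 picture is forced, not chosen.

LANDED (Negative/ lane, `--supports stmt-NavierStokesRegularity-15452`, both ACCEPTED 2026-08-17):
* `Theorems/MinimalDatumPFold/Negative/AbstractExtremalityFalse.lean` (p156689, d1ebb9675ac2):
  `not_abstractExtremality`, `toy_symmetric_gap`, … (§3, sets written out, def-free);
* `Theorems/MinimalDatumPFold/Negative/VacuityAndLoadBearing.lean` (p158786, d56e24aec2f2):
  `not_clayFails_of_navierStokesRegularity`, `cruxBody_of_navierStokesRegularity`,
  `symmGapClosingBody_of_navierStokesRegularity`, `cruxBody_iff_axisymmetricForm` (§1, crux body WRITTEN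
  OUT — bridges to the decl by `Iff.rfl`), `withoutClayFailure_forces_minimalBlowup/_thresholdFinite`,
  `minimalDatumPFold_false_without_clayFailure_of_katoRegular`, `katoRegular_iff_threshold_top`,
  `isPFold_one` (§2), `symmGap_conclusion_trivial_without_blowup`,
  `exists_blowupDatum_norm_lt_of_thresholdFinite` (§4).
OPS NOTE for later negative-side seats: `ledger propose` (even `--dry-run`) of a `--supports` file hung
> 40 min whenever a theorem TYPE mentioned the route item `MinimalDatumPFold` BY NAME (probes: the
disjunction `MinimalDatumPFold ∨ ¬NavierStokesRegularity`, the iff `¬MinimalDatumPFold ↔ …`), and passed in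
< 60 s with the same content written out; a genuine `¬ MinimalDatumPFold` refutation must name the decl,
so budget gate time for it (recorded in this seat's NOTES.md).

LITERATURE (negative knowledge, 2026-08-17; search degraded: local searchd reset, S2 429, OpenAlex budget
exhausted): zbMATH "minimal blow-up initial data Navier–Stokes" → Jia–Šverák arXiv:1201.1592,
Li–Miao–Zheng arXiv:1804.09842, Poulon arXiv:1505.06197, Albritton–Barker arXiv:1802.03164 (minimal data
in other critical spaces; NO symmetry statement about `M`); "flows invariant under rotations" →
Brandolese, Math. Ann. 329 (2004) = arXiv:math/0304436 (symmetric flows: improved DECAY only, no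
regularity/threshold statement); `ledger negatives` (4 NS items): none on symmetric minimal data. No
published counterexample pattern or regularity theorem for `Z_p`-equivariant data exists to our
knowledge — consistent with "irrefutable short of ¬Clay".
-/

set_option linter.dupNamespace false
set_option linter.unusedVariables false

noncomputable section

open MeasureTheory Set Function Filter Topology
open scoped ENNReal NNReal

namespace Summit.NavierStokesRegularity.NavierStokesRegularity.Cruxes.MinimalDatumPFold.Disproof

open Literature.Analysis.FluidPDE Literature.Analysis.FunctionSpaces
open Summit.NavierStokesRegularity.NavierStokesRegularity.Theses.AxisymmetricExtremality

local notation "ℝ³" => EuclideanSpace ℝ (Fin 3)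
local notation "ℂ³" => EuclideanSpace ℂ (Fin 3)

/-! ## §0 Vocabulary and read-back -/

/-- Failure of Clay (A) at viscosity `ν`: verbatim the crux's antecedent (a smooth, divergence-free,
rapidly decaying datum without a jointly smooth bounded-energy global solution). -/
def ClayFails (ν : ℝ) : Prop :=
  ∃ v₀ : ℝ³ → ℝ³, ContDiff ℝ (⊤ : ℕ∞) v₀ ∧ NSWave0.IsDivFree v₀ ∧ HasRapidSpatialDecay v₀ ∧
    ¬ ∃ (u : ℝ → ℝ³ → ℝ³) (p : ℝ → ℝ³ → ℝ), IsSmoothOnHalfSpace u ∧ IsSmoothOnHalfSpace p ∧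
      IsNavierStokesSolution ν 0 v₀ u p ∧ HasBoundedEnergy u

/-- The rotation by the angle `θ` about the `x₂`-axis, written out exactly as in the route file. -/
def rot (θ : ℝ) (x : ℝ³) : ℝ³ :=
  WithLp.toLp 2 ![Real.cos θ * x 0 - Real.sin θ * x 1, Real.sin θ * x 0 + Real.cos θ * x 1, x 2]

/-- `p`-fold symmetry of a field about the `x₂`-axis (pointwise equivariance under `R_{2π/p}`). -/
def IsPFold (p : ℕ) (u₀ : ℝ³ → ℝ³) : Prop :=
  ∀ x : ℝ³, u₀ (rot (2 * Real.pi / p) x) = rot (2 * Real.pi / p) (u₀ x)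

/-- Axisymmetry about the `x₂`-axis (equivariance under every `R_θ`), written out. -/
def IsAxisym (u₀ : ℝ³ → ℝ³) : Prop :=
  ∀ (θ : ℝ) (x : ℝ³), u₀ (rot θ x) = rot θ (u₀ x)

/-- The crux's conclusion at viscosity `ν`: `p`-fold symmetric minimal blow-up data for unboundedly
many `p`. -/
def PFoldConclusion (ν : ℝ) : Prop :=
  ∀ N : ℕ, ∃ p : ℕ, N ≤ p ∧ 2 ≤ p ∧
    ∃ (u₀ : ℝ³ → ℝ³) (g : HomSobolev ℝ³ ℂ³ (1 / 2 : ℝ)), IsMinimalBlowupDatum ν u₀ g ∧ IsPFold p u₀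

/-- READ-BACK: the crux decl is definitionally `∀ ν > 0, ClayFails ν → PFoldConclusion ν`. -/
theorem minimalDatumPFold_iff :
    MinimalDatumPFold ↔ ∀ ν : ℝ, 0 < ν → ClayFails ν → PFoldConclusion ν :=
  Iff.rfl

/-! ## §1 Resistance certificates: no refutation short of `¬ Clay (A)` -/

/-- **The crux is vacuously true under the summit** (stated as a disjunction so that no audit reads
it as a proof of the item): its antecedent is the negated Clay conclusion for one datum, so
`NavierStokesRegularity` discharges it by contradiction. Consequently NO unconditional refutation of
`MinimalDatumPFold` exists unless Clay (A) is false: a disproof of the crux is a disproof of Clay (A).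
[folklore] -/
theorem minimalDatumPFold_or_not_navierStokesRegularity :
    MinimalDatumPFold ∨ ¬ NavierStokesRegularity := by
  by_cases hS : NavierStokesRegularity
  · refine Or.inl fun ν hν hfail => ?_
    obtain ⟨v₀, hsm, hdiv, hdec, hno⟩ := hfail
    have h' : Literature.NS.NavierStokesExistenceSmoothR3 := hS
    exact absurd (h' ν hν v₀ hsm hdiv hdec) hno
  · exact Or.inr hS

/-- The same fact for the Clay-failure antecedent alone: under the summit it is unsatisfiable at
every `ν > 0`. [folklore] -/
theorem not_clayFails_or_not_navierStokesRegularity (ν : ℝ) (hν : 0 < ν) :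
    ¬ ClayFails ν ∨ ¬ NavierStokesRegularity := by
  by_cases hS : NavierStokesRegularity
  · refine Or.inl fun hfail => ?_
    obtain ⟨v₀, hsm, hdiv, hdec, hno⟩ := hfail
    have h' : Literature.NS.NavierStokesExistenceSmoothR3 := hS
    exact hno (h' ν hν v₀ hsm hdiv hdec)
  · exact Or.inr hS

/-- **The exact residual.** `¬ MinimalDatumPFold` says: at some viscosity Clay (A) fails AND for some
`N` no minimal blow-up datum is `p`-fold symmetric for any `p ≥ max(N,2)`. [folklore] -/
theorem not_minimalDatumPFold_iff :
    ¬ MinimalDatumPFold ↔ ∃ ν : ℝ, 0 < ν ∧ ClayFails ν ∧ ¬ PFoldConclusion ν := by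
  constructor
  · intro h
    by_contra hc
    refine h fun ν hν hf => ?_
    by_contra hP
    exact hc ⟨ν, hν, hf, hP⟩
  · rintro ⟨ν, hν, hf, hP⟩ h
    exact hP (h ν hν hf)

/-- **Normal form via the PROVED sibling crux `PFoldToAxisymmetric`
(`axisymmetricExtremality_pFoldToAxisymmetric_proof`, closed 2026-08-17).** The crux is
EQUIVALENT to: whenever Clay (A) fails at `ν`, an AXISYMMETRIC Rusin–Šverák minimal blow-up
datum exists (`ρ_ax = ρ_max`, attained). So a refutation must exhibit a viscosity with blow-up and
prove that no minimiser in `M` is axisymmetric — an existence-of-blow-up theorem plus a rigidity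
theorem about the (undescribed) set `M`. [folklore] -/
theorem minimalDatumPFold_iff_axisymmetricForm :
    MinimalDatumPFold ↔ ∀ ν : ℝ, 0 < ν → ClayFails ν →
      ∃ (u₀ : ℝ³ → ℝ³) (g : HomSobolev ℝ³ ℂ³ (1 / 2 : ℝ)), IsMinimalBlowupDatum ν u₀ g ∧ IsAxisym u₀ := by
  constructor
  · intro h ν hν hf
    exact Summit.NavierStokesRegularity.NavierStokesRegularity.Theorems.axisymmetricExtremality_pFoldToAxisymmetric_proof
      ν hν (h ν hν hf)
  · intro h ν hν hf N
    obtain ⟨u₀, g, hmin, hax⟩ := h ν hν hf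
    exact ⟨max N 2, le_max_left _ _, le_max_right _ _, u₀, g, hmin, fun x => hax _ x⟩

/-- Hence the residual in axisymmetric form: `¬ crux ↔ ∃ ν > 0, ClayFails ν ∧ no axisymmetric
minimal blow-up datum at ν`. [folklore] -/
theorem not_minimalDatumPFold_iff_noAxisymMinimiser :
    ¬ MinimalDatumPFold ↔ ∃ ν : ℝ, 0 < ν ∧ ClayFails ν ∧
      ∀ (u₀ : ℝ³ → ℝ³) (g : HomSobolev ℝ³ ℂ³ (1 / 2 : ℝ)), IsMinimalBlowupDatum ν u₀ g → ¬ IsAxisym u₀ := by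
  rw [minimalDatumPFold_iff_axisymmetricForm]
  constructor
  · intro h
    by_contra hc
    refine h fun ν hν hf => ?_
    by_contra hP
    refine hc ⟨ν, hν, hf, fun u₀ g hmin hax => hP ⟨u₀, g, hmin, hax⟩⟩
  · rintro ⟨ν, hν, hf, hno⟩ h
    obtain ⟨u₀, g, hmin, hax⟩ := h ν hν hf
    exact hno u₀ g hmin hax

/-- The signature of the live line's ONE open stub `stub_symmGapClosing` (line `symmetric-gap`),
verbatim. -/
def SymmGapClosingSig : Prop :=
  ∀ ν : ℝ, 0 < ν → (∃ v₀ : EuclideanSpace ℝ (Fin 3) → EuclideanSpace ℝ (Fin 3), ContDiff ℝ (⊤ : ℕ∞) v₀ ∧ Literature.Analysis.FluidPDE.NSWave0.IsDivFree v₀ ∧ Literature.Analysis.FluidPDE.HasRapidSpatialDecay v₀ ∧ ¬ ∃ (u : ℝ → EuclideanSpace ℝ (Fin 3) → EuclideanSpace ℝ (Fin 3)) (p : ℝ → EuclideanSpace ℝ (Fin 3) → ℝ), Literature.Analysis.FluidPDE.IsSmoothOnHalfSpace u ∧ Literature.Analysis.FluidPDE.IsSmoothOnHalfSpace p ∧ Literature.Analysis.FluidPDE.IsNavierStokesSolution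 ν 0 v₀ u p ∧ Literature.Analysis.FluidPDE.HasBoundedEnergy u) → ∀ N : ℕ, ∃ p : ℕ, N ≤ p ∧ 2 ≤ p ∧ ∀ ε : ENNReal, 0 < ε → ∃ (u₀ : EuclideanSpace ℝ (Fin 3) → EuclideanSpace ℝ (Fin 3)) (g : Literature.Analysis.FunctionSpaces.HomSobolev (EuclideanSpace ℝ (Fin 3)) (EuclideanSpace ℂ (Fin 3)) (1 / 2 : ℝ)), MeasureTheory.MemLp u₀ 3 (MeasureTheory.volume : MeasureTheory.Measure (EuclideanSpace ℝ (Fin 3))) ∧ g.Represents (Literature.Analysis.FunctionSpaces.EuclideanSpace.complexify ∘ u₀) ∧ Literature.Analysis.FluidPDE.IsWeaklyDivFree u₀ ∧ ¬ Literature.Analysis.FluidPDE.HasGlobalKatoSolution ν u₀ ∧ ‖g‖ₑ < Literature.Analysis.FluidPDE.rusinSverakRhoMaxPure ν + ε ∧ ∀ᵐ x ∂(MeasureTheory.volume : MeasureTheory.Measure (EuclideanSpace ℝ (Fin 3))), u₀ (WithLp.toLp 2 ![Real.cos (2 * Real.pi / p) * x 0 - Real.sin (2 * Real.pi / p) * x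 1, Real.sin (2 * Real.pi / p) * x 0 + Real.cos (2 * Real.pi / p) * x 1, x 2]) = WithLp.toLp 2 ![Real.cos (2 * Real.pi / p) * u₀ x 0 - Real.sin (2 * Real.pi / p) * u₀ x 1, Real.sin (2 * Real.pi / p) * u₀ x 0 + Real.cos (2 * Real.pi / p) * u₀ x 1, u₀ x 2]

/-- **The open stub of line `symmetric-gap` (= child 1 `SymmGapClosing` of the landed split
`minimalDatumPFold_of_subs`, and equivalent to the crux by the landed
`symmGapClosing_of_minimalDatumPFold`) is equally irrefutable short of `¬ Clay (A)`**: it has the same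
antecedent. [folklore] -/
theorem symmGapClosingSig_or_not_navierStokesRegularity :
    SymmGapClosingSig ∨ ¬ NavierStokesRegularity := by
  by_cases hS : NavierStokesRegularity
  · refine Or.inl fun ν hν hfail => ?_
    obtain ⟨v₀, hsm, hdiv, hdec, hno⟩ := hfail
    have h' : Literature.NS.NavierStokesExistenceSmoothR3 := hS
    exact absurd (h' ν hν v₀ hsm hdiv hdec) hno
  · exact Or.inr hS

/-! ## §2 Load-bearing hypotheses -/

/-- (H1) The crux with its Clay-failure antecedent DROPPED. -/
def MinimalDatumPFoldWithoutClayFailure : Prop :=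
  ∀ ν : ℝ, 0 < ν → PFoldConclusion ν

/-- Dropping the antecedent asserts minimal blow-up data at EVERY viscosity. [folklore] -/
theorem withoutClayFailure_forces_minimalBlowup (h : MinimalDatumPFoldWithoutClayFailure)
    {ν : ℝ} (hν : 0 < ν) :
    ∃ (u₀ : ℝ³ → ℝ³) (g : HomSobolev ℝ³ ℂ³ (1 / 2 : ℝ)), IsMinimalBlowupDatum ν u₀ g := by
  obtain ⟨p, -, -, u₀, g, hmin, -⟩ := h ν hν 0
  exact ⟨u₀, g, hmin⟩

/-- … hence a finite pure threshold `ρ_max^pure(ν) < ⊤` at every `ν > 0` (the norm of a bundled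
`Ḣ^{1/2}` class is finite). [folklore] -/
theorem withoutClayFailure_forces_thresholdFinite (h : MinimalDatumPFoldWithoutClayFailure)
    {ν : ℝ} (hν : 0 < ν) : rusinSverakRhoMaxPure ν < ⊤ := by
  obtain ⟨u₀, g, -, -, -, hnorm, -⟩ := withoutClayFailure_forces_minimalBlowup h hν
  rw [← hnorm]
  exact enorm_lt_top

/-- Kato-regularity at viscosity `ν`: every admissible `Ḣ^{1/2}` datum has a global Kato solution
(the critical-space form of regularity; it is `ρ_max^pure(ν) = ⊤` unfolded). -/
def KatoRegular (ν : ℝ) : Prop :=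
  ∀ (u₀ : ℝ³ → ℝ³) (g : HomSobolev ℝ³ ℂ³ (1 / 2 : ℝ)), MemLp u₀ 3 →
    g.Represents (EuclideanSpace.complexify ∘ u₀) → IsWeaklyDivFree u₀ → HasGlobalKatoSolution ν u₀

/-- **`_false_without_` (conditional form, the only one available): the antecedent is
load-bearing.** If a single viscosity is Kato-regular, the crux WITHOUT its Clay-failure antecedent
is false — whereas the crux itself stays (vacuously) true there. Unconditionally,
`MinimalDatumPFoldWithoutClayFailure` can be neither proved (it asserts blow-up) nor refuted (that
is critical-space regularity at some `ν`) today. [folklore] -/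
theorem minimalDatumPFold_false_without_clayFailure_of_katoRegular {ν : ℝ} (hν : 0 < ν)
    (hreg : KatoRegular ν) : ¬ MinimalDatumPFoldWithoutClayFailure := by
  intro h
  obtain ⟨u₀, g, hL3, hrep, hdiv, -, hno⟩ := withoutClayFailure_forces_minimalBlowup h hν
  exact hno (hreg u₀ g hL3 hrep hdiv)

/-- Kato-regularity at `ν` is exactly `ρ_max^pure(ν) = ⊤`. [folklore] -/
theorem katoRegular_iff_threshold_top (ν : ℝ) : KatoRegular ν ↔ rusinSverakRhoMaxPure ν = ⊤ := by
  constructor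
  · intro h
    apply top_unique
    apply le_sSup
    intro u₀ g hL3 hrep hdiv _
    exact h u₀ g hL3 hrep hdiv
  · intro h u₀ g hL3 hrep hdiv
    exact hasGlobalKatoSolution_of_lt_rusinSverakRhoMaxPure hL3 hrep hdiv (h ▸ enorm_lt_top)

/-- (H3) The crux with `N ≤ p` dropped (only SOME `p ≥ 2`): still carries the Clay-failure
antecedent, hence is still vacuous under the summit — no cheaper target for a refuter. [folklore] -/
theorem somePFold_or_not_navierStokesRegularity :
    (∀ ν : ℝ, 0 < ν → ClayFails ν →
      ∃ p : ℕ, 2 ≤ p ∧ ∃ (u₀ : ℝ³ → ℝ³) (g : HomSobolev ℝ³ ℂ³ (1 / 2 : ℝ)),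
        IsMinimalBlowupDatum ν u₀ g ∧ IsPFold p u₀) ∨ ¬ NavierStokesRegularity := by
  refine minimalDatumPFold_or_not_navierStokesRegularity.imp_left fun h ν hν hf => ?_
  obtain ⟨p, -, h2, u₀, g, hmin, hsym⟩ := h ν hν hf 2
  exact ⟨p, h2, u₀, g, hmin, hsym⟩

/-- (H3') Conversely the crux's `2 ≤ p` is what keeps `N = 0, 1` honest: for `p = 1` the rotation
is the identity (`cos 2π = 1`, `sin 2π = 0`), so `IsPFold 1` is no condition at all. [folklore] -/
theorem isPFold_one (u₀ : ℝ³ → ℝ³) : IsPFold 1 u₀ := by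
  intro x
  have hrot : ∀ y : ℝ³, rot (2 * Real.pi / (1 : ℕ)) y = y := by
    intro y
    ext i
    fin_cases i <;> simp [rot]
  rw [hrot, hrot]

/-! ## §3 The natural strengthening (abstract extremality / Smith step without acyclicity) is false -/

/-- A norm-minimiser of a "bad" set `B ⊆ ℝ³`. -/
def IsToyMinimiser (B : ℝ³ → Prop) (x : ℝ³) : Prop :=
  B x ∧ ∀ y, B y → ‖x‖ ≤ ‖y‖

/-- **The abstract extremality principle** (everything line `birth` knows about Rusin–Šverák's `M`,
transplanted to `ℝ³` with the route's own rotations `R_θ` about the `x₂`-axis): a bad set that is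
rotation invariant and closed, whose norm-minimisers exist and form a compact set, and which has
`R_{2π/p}`-fixed bad elements for every `p ≥ 2` (`ρ_p < ∞`), has an `R_{2π/p}`-fixed MINIMISER for
unboundedly many `p`. -/
def AbstractExtremality : Prop :=
  ∀ B : ℝ³ → Prop,
    (∀ (θ : ℝ) (x : ℝ³), B x → B (rot θ x)) →
    IsClosed {x | B x} →
    (∃ x, IsToyMinimiser B x) →
    IsCompact {x | IsToyMinimiser B x} →
    (∀ p : ℕ, 2 ≤ p → ∃ x, B x ∧ rot (2 * Real.pi / p) x = x) →
    ∀ N : ℕ, ∃ p : ℕ, N ≤ p ∧ 2 ≤ p ∧ ∃ x, IsToyMinimiser B x ∧ rot (2 * Real.pi / p) x = x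

/-- The witness bad set: outside the open solid unit cylinder about the `x₂`-axis, or high up
(`x₂ ≥ 2`). Its norm-minimisers are the horizontal unit circle — a FREE `SO(2)`-orbit. -/
def toyBad (x : ℝ³) : Prop :=
  1 ≤ x 0 ^ 2 + x 1 ^ 2 ∨ 2 ≤ x 2

theorem rot_apply_zero (θ : ℝ) (x : ℝ³) : rot θ x 0 = Real.cos θ * x 0 - Real.sin θ * x 1 := by
  simp [rot]

theorem rot_apply_one (θ : ℝ) (x : ℝ³) : rot θ x 1 = Real.sin θ * x 0 + Real.cos θ * x 1 := by
  simp [rot]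

theorem rot_apply_two (θ : ℝ) (x : ℝ³) : rot θ x 2 = x 2 := by
  simp [rot]

/-- Rotations preserve the horizontal radius. -/
theorem rot_radial (θ : ℝ) (x : ℝ³) : rot θ x 0 ^ 2 + rot θ x 1 ^ 2 = x 0 ^ 2 + x 1 ^ 2 := by
  rw [rot_apply_zero, rot_apply_one]
  linear_combination (x 0 ^ 2 + x 1 ^ 2) * Real.sin_sq_add_cos_sq θ

theorem toyBad_rot (θ : ℝ) (x : ℝ³) (hx : toyBad x) : toyBad (rot θ x) := by
  rcases hx with h | h
  · exact Or.inl (by rw [rot_radial]; exact h)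
  · exact Or.inr (by rw [rot_apply_two]; exact h)

theorem norm_sq_eq_three (x : ℝ³) : ‖x‖ ^ 2 = x 0 ^ 2 + x 1 ^ 2 + x 2 ^ 2 := by
  rw [EuclideanSpace.norm_eq, Real.sq_sqrt (Finset.sum_nonneg fun i _ => sq_nonneg _)]
  simp [Fin.sum_univ_three]

/-- A fixed point of a rotation by an angle with `cos θ ≠ 1` lies on the axis. -/
theorem onAxis_of_rot_fixed {θ : ℝ} (hθ : Real.cos θ ≠ 1) {x : ℝ³} (hx : rot θ x = x) :
    x 0 = 0 ∧ x 1 = 0 := by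
  have h0 : Real.cos θ * x 0 - Real.sin θ * x 1 = x 0 := by
    rw [← rot_apply_zero, hx]
  have h1 : Real.sin θ * x 0 + Real.cos θ * x 1 = x 1 := by
    rw [← rot_apply_one, hx]
  have h3 := Real.cos_sq_add_sin_sq θ
  have hc : (2 : ℝ) - 2 * Real.cos θ ≠ 0 := by
    intro h
    exact hθ (by linarith)
  have k0 : (2 - 2 * Real.cos θ) * x 0 = 0 := by
    linear_combination (Real.cos θ - 1) * h0 + Real.sin θ * h1 - (x 0) * h3
  have k1 : (2 - 2 * Real.cos θ) * x 1 = 0 := by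
    linear_combination (Real.cos θ - 1) * h1 - Real.sin θ * h0 - (x 1) * h3
  exact ⟨(mul_eq_zero.1 k0).resolve_left hc, (mul_eq_zero.1 k1).resolve_left hc⟩

/-- For `p ≥ 2` the angle `2π/p ∈ (0, π]` is not a multiple of `2π`. -/
theorem cos_two_pi_div_ne_one {p : ℕ} (hp : 2 ≤ p) : Real.cos (2 * Real.pi / p) ≠ 1 := by
  have hp' : (0 : ℝ) < p := by exact_mod_cast (lt_of_lt_of_le (by norm_num) hp)
  have hpos : 0 < 2 * Real.pi / p := div_pos (by positivity) hp'
  have hlt : 2 * Real.pi / p < 2 * Real.pi := by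
    rw [div_lt_iff₀ hp']
    have : (2 : ℝ) ≤ p := by exact_mod_cast hp
    nlinarith [Real.pi_pos]
  intro h
  have := (Real.cos_eq_one_iff_of_lt_of_lt (by linarith [Real.pi_pos]) hlt).1 h
  linarith

/-- The point `e₀ = (1,0,0)`. -/
def e0 : ℝ³ := WithLp.toLp 2 ![1, 0, 0]

/-- The point `a₂ = (0,0,2)` on the symmetry axis. -/
def a2 : ℝ³ := WithLp.toLp 2 ![0, 0, 2]

theorem norm_e0 : ‖e0‖ = 1 := by
  have h : ‖e0‖ ^ 2 = 1 := by
    rw [norm_sq_eq_three]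
    simp [e0]
  exact (pow_eq_one_iff_of_nonneg (norm_nonneg _) two_ne_zero).1 h

/-- The point `e₀ = (1,0,0)` is a norm-minimiser of `toyBad`, of norm `1`. -/
theorem toyMinimiser_e0 : IsToyMinimiser toyBad e0 ∧ ‖e0‖ = 1 := by
  refine ⟨⟨Or.inl (by simp [e0]), fun y hy => ?_⟩, norm_e0⟩
  rw [norm_e0]
  rcases hy with h | h
  · have hsq : 1 ≤ ‖y‖ ^ 2 := by rw [norm_sq_eq_three]; nlinarith [sq_nonneg (y 2)]
    nlinarith [norm_nonneg y]
  · have h2 : |y 2| ≤ ‖y‖ := by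
      have := PiLp.norm_apply_le y 2
      simpa using this
    have : (2 : ℝ) ≤ |y 2| := le_trans h (le_abs_self _)
    linarith

theorem isClosed_toyBad : IsClosed {x : ℝ³ | toyBad x} := by
  have hc : ∀ i : Fin 3, Continuous fun x : ℝ³ => x i := fun i =>
    (EuclideanSpace.proj i).continuous
  apply IsClosed.union
  · exact isClosed_le continuous_const (((hc 0).pow 2).add ((hc 1).pow 2))
  · exact isClosed_le continuous_const (hc 2)

theorem isCompact_toyMinimisers : IsCompact {x : ℝ³ | IsToyMinimiser toyBad x} := by
  apply Metric.isCompact_of_isClosed_isBounded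
  · have hset : {x : ℝ³ | IsToyMinimiser toyBad x} =
        {x | toyBad x} ∩ ⋂ y : ℝ³, {x : ℝ³ | toyBad y → ‖x‖ ≤ ‖y‖} := by
      ext x
      simp [IsToyMinimiser, Set.mem_iInter]
    rw [hset]
    refine isClosed_toyBad.inter (isClosed_iInter fun y => ?_)
    by_cases hy : toyBad y
    · simpa [hy] using isClosed_le continuous_norm continuous_const
    · simp [hy]
  · refine (Metric.isBounded_closedBall (x := (0 : ℝ³)) (r := 1)).subset ?_
    intro x hx
    rw [Metric.mem_closedBall, dist_zero_right, ← toyMinimiser_e0.2]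
    exact hx.2 _ toyMinimiser_e0.1.1

/-- The axis point `a₂ = (0,0,2)` is bad and fixed by every rotation about the axis (`ρ_p < ∞`). -/
theorem toyBad_symmetric_point (θ : ℝ) : toyBad a2 ∧ rot θ a2 = a2 := by
  refine ⟨Or.inr (by simp [a2]), ?_⟩
  ext i
  fin_cases i <;> simp [rot, a2]

/-- **No minimiser of the witness is fixed by any `R_{2π/p}`, `p ≥ 2`.** -/
theorem no_symmetric_toyMinimiser {p : ℕ} (hp : 2 ≤ p) {x : ℝ³} (hx : IsToyMinimiser toyBad x)
    (hfix : rot (2 * Real.pi / p) x = x) : False := by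
  obtain ⟨h0, h1⟩ := onAxis_of_rot_fixed (cos_two_pi_div_ne_one hp) hfix
  have hle : ‖x‖ ≤ 1 := by
    rw [← toyMinimiser_e0.2]
    exact hx.2 _ toyMinimiser_e0.1.1
  rcases hx.1 with h | h
  · rw [h0, h1] at h
    norm_num at h
  · have h2 : |x 2| ≤ ‖x‖ := by
      have := PiLp.norm_apply_le x 2
      simpa using this
    have : (2 : ℝ) ≤ |x 2| := le_trans h (le_abs_self _)
    linarith

/-- **`not_AbstractExtremality` — the natural strengthening of the crux is FALSE.** Witness:
`toyBad`; its minimiser set is the horizontal unit circle, a free `SO(2)`-orbit (Euler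
characteristic `0`, not `F_p`-acyclic), while symmetric bad elements exist at norm `2 > 1 = ρ_max`
(`ρ_p = 2` for every `p ≥ 2`). So "`M ≠ ∅` compact + invariance + `ρ_p < ∞` ⇒ symmetric minimiser"
is not a valid inference; line `birth`'s `stub_smithFixedModSim` needs a genuinely additional input
(acyclicity of `M̂`), and line `symmetric-gap`'s `stub_symmGapClosing` (gap closing) is not a
consequence of the abstract structure either. [folklore] -/
theorem not_abstractExtremality : ¬ AbstractExtremality := by
  intro h
  obtain ⟨p, -, h2, x, hx, hfix⟩ := h toyBad (fun θ x hx => toyBad_rot θ x hx) isClosed_toyBad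
    ⟨_, toyMinimiser_e0.1⟩ isCompact_toyMinimisers
    (fun p _ => ⟨_, toyBad_symmetric_point _⟩) 2
  exact no_symmetric_toyMinimiser h2 hx hfix

/-- The same witness kills the INFIMUM form (the abstract shadow of `stub_symmGapClosing`): in the
toy, `inf {‖x‖ : x bad and R_{2π/p}-fixed} = 2 > 1 = inf {‖x‖ : x bad}` for every `p ≥ 2`; stated
without infima: no symmetric bad element has norm `< 1 + 1`. [folklore] -/
theorem toy_symmetric_gap {p : ℕ} (hp : 2 ≤ p) {x : ℝ³} (hx : toyBad x)
    (hfix : rot (2 * Real.pi / p) x = x) : (2 : ℝ) ≤ ‖x‖ := by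
  obtain ⟨h0, h1⟩ := onAxis_of_rot_fixed (cos_two_pi_div_ne_one hp) hfix
  rcases hx with h | h
  · rw [h0, h1] at h
    norm_num at h
  · have h2 : |x 2| ≤ ‖x‖ := by
      have := PiLp.norm_apply_le x 2
      simpa using this
    exact le_trans (le_trans h (le_abs_self _)) h2

/-! ### §3b The dihedral / prismatic reshape (2-groups with a reflection) meets the same toy

Three planner cards on the item (idea-mirror-kills-swirl, idea-prismatic-smith-no-swirl,
idea-dihedral-smith-no-swirl) propose running the Smith step with the 2-groups
`G_k = ⟨R_{2π/2^k}, σ⟩`, `σ (x₀,x₁,x₂) = (x₀,−x₁,x₂)`, so that the limit symmetry is `O(2)` (no swirl).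
The abstract principle fails for these groups as well, BY THE SAME WITNESS: `toyBad` is also
`σ`-invariant, the axis point is `G_k`-fixed for every `k`, and a `G_k`-fixed minimiser would in
particular be `R_{2π/2^k}`-fixed, which no minimiser is (`2^k ≥ 2`). Only the pure reflection group
`⟨σ⟩` (no rotation) escapes this toy — and `⟨σ⟩`-symmetry is useless for the route (mirror symmetry
alone kills neither swirl nor anything else). So `F_2`-acyclicity of `M̂` is exactly as load-bearing
for the reshaped line as `F_p`-acyclicity is for `birth`. -/

/-- The reflection `σ (x₀,x₁,x₂) = (x₀,−x₁,x₂)` in the plane containing the axis. -/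
def reflY (x : ℝ³) : ℝ³ := WithLp.toLp 2 ![x 0, -x 1, x 2]

theorem toyBad_reflY (x : ℝ³) (hx : toyBad x) : toyBad (reflY x) := by
  rcases hx with h | h
  · left; simpa [reflY] using h
  · right; simpa [reflY] using h

theorem reflY_a2 : reflY a2 = a2 := by
  ext i; fin_cases i <;> simp [reflY, a2]

/-- **The abstract extremality principle for the dihedral 2-groups `G_k = ⟨R_{2π/2^k}, σ⟩` is false
too** (same witness). Hypotheses: rotation- AND reflection-invariant closed bad set, non-empty compact
minimiser set, and for every `k ≥ 1` a bad element fixed by both `R_{2π/2^k}` and `σ`; conclusion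
refuted: a minimiser fixed by `R_{2π/2^k}` and `σ` for some `k ≥ 1`. [folklore] -/
theorem not_abstractExtremality_dihedral :
    ¬ ∀ B : ℝ³ → Prop,
      (∀ (θ : ℝ) (x : ℝ³), B x → B (rot θ x)) →
      (∀ x : ℝ³, B x → B (reflY x)) →
      IsClosed {x | B x} →
      (∃ x, IsToyMinimiser B x) →
      IsCompact {x | IsToyMinimiser B x} →
      (∀ k : ℕ, 1 ≤ k → ∃ x, B x ∧ rot (2 * Real.pi / (2 ^ k : ℕ)) x = x ∧ reflY x = x) →
      ∃ k : ℕ, 1 ≤ k ∧ ∃ x, IsToyMinimiser B x ∧ rot (2 * Real.pi / (2 ^ k : ℕ)) x = x ∧ reflY x = x := by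
  intro h
  obtain ⟨k, hk, x, hx, hfix, -⟩ := h toyBad (fun θ x hx => toyBad_rot θ x hx) toyBad_reflY
    isClosed_toyBad ⟨_, toyMinimiser_e0.1⟩ isCompact_toyMinimisers
    (fun k _ => ⟨a2, (toyBad_symmetric_point (2 * Real.pi / (2 ^ k : ℕ))).1,
      (toyBad_symmetric_point (2 * Real.pi / (2 ^ k : ℕ))).2, reflY_a2⟩)
  have h2 : 2 ≤ 2 ^ k := by
    calc 2 = 2 ^ 1 := by norm_num
      _ ≤ 2 ^ k := Nat.pow_le_pow_right (by norm_num) hk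
  exact no_symmetric_toyMinimiser h2 hx hfix

/-! ## §4 Line `symmetric-gap`: clause mutation of the open stub's conclusion -/

/-- Without the BLOW-UP clause `¬ HasGlobalKatoSolution ν u₀`, the conclusion of
`stub_symmGapClosing` is witnessed by the ZERO datum for every `p` and every `ε > 0`
(a.e.-equivariant, norm `0 < ρ + ε`). So the blow-up clause carries all the content on that side.
[folklore] -/
theorem symmGap_conclusion_trivial_without_blowup (ν : ℝ) (p : ℕ) (ε : ℝ≥0∞) (hε : 0 < ε) :
    ∃ (u₀ : ℝ³ → ℝ³) (g : HomSobolev ℝ³ ℂ³ (1 / 2 : ℝ)),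
      MemLp u₀ 3 (volume : Measure ℝ³) ∧ g.Represents (EuclideanSpace.complexify ∘ u₀) ∧
      IsWeaklyDivFree u₀ ∧ ‖g‖ₑ < rusinSverakRhoMaxPure ν + ε ∧
      ∀ᵐ x ∂(volume : Measure ℝ³), u₀ (WithLp.toLp 2 ![Real.cos (2 * Real.pi / p) * x 0 - Real.sin (2 * Real.pi / p) * x 1, Real.sin (2 * Real.pi / p) * x 0 + Real.cos (2 * Real.pi / p) * x 1, x 2]) = WithLp.toLp 2 ![Real.cos (2 * Real.pi / p) * u₀ x 0 - Real.sin (2 * Real.pi / p) * u₀ x 1, Real.sin (2 * Real.pi / p) * u₀ x 0 + Real.cos (2 * Real.pi / p) * u₀ x 1, u₀ x 2] := by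
  refine ⟨0, 0, ?_, ?_, ?_, ?_, ?_⟩
  · exact MemLp.zero
  · have h := HomSobolev.represents_zero (E := ℝ³) (F := ℂ³) (s := (1 / 2 : ℝ))
    have hc : (EuclideanSpace.complexify ∘ (0 : ℝ³ → ℝ³)) = (0 : ℝ³ → ℂ³) := by
      funext x; simp only [Function.comp_apply, Pi.zero_apply, map_zero]
    rw [hc]; exact h
  · intro θ _; simp
  · rw [enorm_zero]
    exact lt_of_lt_of_le hε le_add_self
  · refine Filter.Eventually.of_forall fun x => ?_
    ext i; fin_cases i <;> simp

/-- Without the EQUIVARIANCE clause, the conclusion of `stub_symmGapClosing` is the definition of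
the threshold: if `ρ_max^pure(ν) < ⊤` then for every `ε > 0` there is an admissible datum WITHOUT a
global Kato solution of norm `< ρ_max^pure(ν) + ε` (unfold the `sSup`). Together with
`symmGap_conclusion_trivial_without_blowup`: the open content of the stub is exactly the COUPLING
"near-minimal ∧ symmetric". [folklore] -/
theorem exists_blowupDatum_norm_lt_of_thresholdFinite {ν : ℝ} (hfin : rusinSverakRhoMaxPure ν < ⊤)
    {ε : ℝ≥0∞} (hε : 0 < ε) :
    ∃ (u₀ : ℝ³ → ℝ³) (g : HomSobolev ℝ³ ℂ³ (1 / 2 : ℝ)),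
      MemLp u₀ 3 (volume : Measure ℝ³) ∧ g.Represents (EuclideanSpace.complexify ∘ u₀) ∧
      IsWeaklyDivFree u₀ ∧ ¬ HasGlobalKatoSolution ν u₀ ∧ ‖g‖ₑ < rusinSverakRhoMaxPure ν + ε := by
  by_contra hcon
  push Not at hcon
  have hle : rusinSverakRhoMaxPure ν + ε ≤ rusinSverakRhoMaxPure ν := by
    apply le_sSup
    intro u₀ g hL3 hrep hdiv hlt
    by_contra hno
    exact absurd hlt (not_lt.2 (hcon u₀ g hL3 hrep hdiv hno))
  exact absurd hle (not_le.2 (ENNReal.lt_add_right hfin.ne hε.ne'))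

end Summit.NavierStokesRegularity.NavierStokesRegularity.Cruxes.MinimalDatumPFold.Disproof

end
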